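import Summits.RiemannHypothesis.RiemannHypothesis.Theorems.HandoffDecompositionConsequences
import Summits.RiemannHypothesis.RiemannHypothesis.Theorems.HandoffEdge
import Summits.RiemannHypothesis.RiemannHypothesis.Theorems.ConnesPropertyPCriterion
import HarnessLib

/-!
# The HANDOFF coupling law is CUMULATIVE: `Coupling(q) ↔ H(q)`, with no induction hypothesis — and the dictionary with Connes's `P(n)`

Cell `rh-explicit`, TRACK «HANDOFF», seat handoff-theory-1 (definitions + logic), gen2.  Companion text:
`HOME/handoff/HANDOFF-STATEMENT.md` §I (v1.2).  Builds on the tree files of record `HandoffWindow.lean`,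
`HandoffSchur.lean`, `HandoffEdge.lean` (prove-2), `HandoffDecomposition{,Consequences}.lean` (this seat) and
`ConnesPropertyPCriterion.lean` (cc-s2-4); re-declares nothing of them.

HONEST FRAMING.  Nothing here is a step towards RH.  This file settles the EXACT LOGICAL STATUS of the Schur
blocks of `HandoffSchur.lean` (prove-2 / idea-2's «L1»: given the induction hypothesis `WeilPositivityOn((log q)/2)`,
`H(q) ↔ EdgeNonneg ∧ HandoffCoupling`).  The finding is NEGATIVE-STRUCTURAL and two lines long once one has a test
function of strictly positive Weil energy in every interval (§1, from Bombieri's Theorem 12 as landed in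
`HandoffEdge.re_weilQuadratic_lobe_ge`):

* `weilPositivityOn_of_handoffCoupling` — **the coupling law at `q` implies Weil positivity on the OLD cone
  `C((log q)/2)`** (test it against one edge-layer function of positive energy: `0 ≤ crossRe² ≤ Re Q(u)·Re Q(h)` with
  `Re Q(h) > 0` forces `Re Q(u) ≥ 0`).  So the coupling law is not an increment: it CONTAINS the induction hypothesis.
* `edgeNonneg_of_handoffCoupling` — the coupling law also implies the edge block (test it against one old-cone
  function of positive energy).
* `handoffCoupling_iff_handoffH` — hence, for consecutive primes `q < q'` and any overlap `0 < η < (log q)/2`,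
  **`HandoffCoupling q q' η ↔ HandoffH q q'`** unconditionally: the coupling law IS Weil positivity on
  `C((log q')/2)`, SANDWICHED between consecutive rungs (`WeilPositivityOn((log q')/2) → Coupling(q) →
  WeilPositivityOn((log q)/2)`).
* `riemannHypothesis_iff_forall_handoffCoupling` — `RH ↔ ∀ q prime, Coupling(q, q⁺, η_q)` for every admissible
  overlap schedule (the edge block and the base drop out), and `riemannHypothesis_iff_exists_forall_handoffCoupling` —
  **the TAIL form `∃ q₀, ∀ q ≥ q₀, Coupling(q)` is ALREADY RH**: no asymptotic discount, in contrast with the increment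
  form `HandoffStep`, whose tail form is a theorem of excluded middle (`exists_forall_handoffStep`, the vacuity trap).
* §4, the dictionary with print: `H(q) → P(n)` for every `n ≤ q⁺` (Connes's property `P(n)`, Connes 2026 §4.1 /
  Connes–Consani–Moscovici 2024 p. 2–3: "a property `P(n)` involving only the Euler factors for primes smaller than
  `n`, whose validity for all `n` is equivalent to RH" — the equivalence-by-windows IN PRINT, on the pole-free class),
  and `(∀ q prime, H q) ↔ ∀ n, P(n)`.  What is new in the tree relative to print is only the no-vanishing-condition
  version indexed by consecutive primes with the deficit/contribution split at the single atom `q`; NOT the existence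
  of an equivalence by windows.

References: Bombieri, Rend. Lincei (9) 11 (2000) §3 (hermitian form), Thm 12 [Bombieri2000Weil]; Connes 2026 §4.1
[Connes2026Letter]; Connes–Consani–Moscovici 2024 p. 2–3 [ConnesConsaniMoscovici2024]; this track: prove-2 ATTEMPT-2/4,
idea-2 IDEAS-explicit-sieve L1.
-/

set_option linter.dupNamespace false  -- the mandated namespace repeats `RiemannHypothesis`

noncomputable section

open Set MeasureTheory Metric Literature.NumberTheory.LFunctions
open Literature.NumberTheory.ConnesConsani2021
open scoped Topology

namespace Summit.RiemannHypothesis.RiemannHypothesis.Theorems.HandoffDecomposition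

variable {q q' : ℕ} {η : ℝ}

/-! ## §1  Test functions of strictly positive Weil energy in every interval -/

/-- `log 12 < 4` (since `12 < e⁴`). [folklore] -/
theorem log_twelve_lt_four : Real.log 12 < 4 := by
  have he : (2.7182818283 : ℝ) < Real.exp 1 := Real.exp_one_gt_d9
  have h4 : Real.exp 4 = Real.exp 1 ^ 4 := by
    rw [show (4 : ℝ) = ((4 : ℕ) : ℝ) * 1 by norm_num, Real.exp_nat_mul]
  have hpow : (2.7182818283 : ℝ) ^ 4 < Real.exp 1 ^ 4 :=
    pow_lt_pow_left₀ he (by norm_num) (by norm_num)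
  have h12 : (12 : ℝ) < Real.exp 4 := by rw [h4]; nlinarith
  calc Real.log 12 < Real.log (Real.exp 4) := Real.log_lt_log (by norm_num) h12
    _ = 4 := Real.log_exp 4

/-- Bombieri's lobe coefficient `log(1/D) − log⁺log(1/D) − 8` is POSITIVE for every width `0 < D ≤ e^{−12}`
(`L − log L − 8 > (11/12)L − 11 ≥ 0` for `L = log(1/D) ≥ 12`, using `log L ≤ log 12 + L/12 − 1`). [cite: Bombieri2000Weil, §12 Thm. 12 (the coefficient); arithmetic = folklore] -/
theorem lobe_coeff_pos {D : ℝ} (hD : 0 < D) (hDe : D ≤ Real.exp (-12)) :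
    0 < Real.log (1 / D) - Real.posLog (Real.log (1 / D)) - 8 := by
  set L : ℝ := Real.log (1 / D) with hL
  have hL12 : 12 ≤ L := by
    have h1 : Real.exp 12 ≤ 1 / D := by
      rw [le_one_div (Real.exp_pos 12) hD, one_div, ← Real.exp_neg]
      exact hDe
    have := Real.log_le_log (Real.exp_pos 12) h1
    rwa [Real.log_exp] at this
  have hLpos : 0 < L := by linarith
  have hpl : Real.posLog L = Real.log L :=
    Real.posLog_eq_log (by rw [abs_of_pos hLpos]; linarith)
  have hlogL : Real.log L ≤ Real.log 12 + (L / 12 - 1) := by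
    have hsplit : Real.log L = Real.log 12 + Real.log (L / 12) := by
      rw [← Real.log_mul (by norm_num) (by positivity)]
      congr 1; ring
    rw [hsplit]
    have := Real.log_le_sub_one_of_pos (show 0 < L / 12 by positivity)
    linarith
  rw [hpl]
  linarith [log_twelve_lt_four]

/-- `e^{−12} < log 2`. [folklore] -/
theorem exp_neg_twelve_lt_log_two : Real.exp (-12) < Real.log 2 := by
  have h1 : Real.exp (-12) < 1 / 2 := by
    rw [Real.exp_neg, lt_div_iff₀ (by norm_num : (0 : ℝ) < 2)]
    have : (12 : ℝ) + 1 ≤ Real.exp 12 := Real.add_one_le_exp 12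
    rw [inv_mul_lt_iff₀ (Real.exp_pos 12)]
    linarith
  linarith [Real.log_two_gt_d9]

/-- **Strictly positive Weil energy in every interval.**  For every `c ∈ ℝ` and every `δ > 0` there is a Weil test
function `φ` (smooth, compactly supported) with `tsupport φ ⊆ [c, c + δ]` and `0 < Re Q(φ)`: a smooth bump of width
`min(δ, e^{−12})`, whose energy is `≥ (log(1/D) − log log(1/D) − 8)·‖φ‖₂² > 0` by Bombieri's Theorem 12 (tree:
`Handoff.re_weilQuadratic_lobe_ge`, translation-invariant form). [cite: Bombieri2000Weil, §12 Thm. 12] -/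
theorem exists_isWeilTest_re_weilQuadratic_pos (c : ℝ) {δ : ℝ} (hδ : 0 < δ) :
    ∃ φ : ℝ → ℂ, IsWeilTest φ ∧ tsupport φ ⊆ Icc c (c + δ) ∧ 0 < (weilQuadratic φ).re := by
  set D : ℝ := min δ (Real.exp (-12)) with hD
  have hDpos : 0 < D := lt_min hδ (Real.exp_pos _)
  have hDδ : D ≤ δ := min_le_left _ _
  have hDe : D ≤ Real.exp (-12) := min_le_right _ _
  let χ : ContDiffBump (c + D / 2) := ⟨D / 4, D / 2, by positivity, by linarith⟩
  set φ : ℝ → ℂ := fun x ↦ ((χ x : ℝ) : ℂ) with hφ_def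
  have hφeq : φ = (fun r : ℝ ↦ (r : ℂ)) ∘ (χ : ℝ → ℝ) := rfl
  have hφ : IsWeilTest φ :=
    ⟨Complex.ofRealCLM.contDiff.comp χ.contDiff, by
      rw [hφeq]; exact χ.hasCompactSupport.comp_left Complex.ofReal_zero⟩
  -- support
  have hts : tsupport φ ⊆ Icc c (c + D) := by
    rw [hφeq]
    refine (tsupport_comp_subset Complex.ofReal_zero _).trans ?_
    rw [χ.tsupport_eq, Real.closedBall_eq_Icc]
    have hr : χ.rOut = D / 2 := rfl
    exact Icc_subset_Icc (by linarith) (by linarith)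
  refine ⟨φ, hφ, hts.trans (Icc_subset_Icc le_rfl (by linarith)), ?_⟩
  -- energy
  have hlen : c + D - c < Real.log 2 := by linarith [exp_neg_twelve_lt_log_two]
  have hge := Handoff.re_weilQuadratic_lobe_ge hφ (c := c) (d := c + D) (by linarith) hlen hts
  rw [show c + D - c = D by ring] at hge
  have hcoef := lobe_coeff_pos hDpos hDe
  -- the L² mass of the bump is positive
  have hnorm : ∀ t : ℝ, ‖φ t‖ ^ 2 = (fun t ↦ χ t * χ t) t := by
    intro t
    simp only [hφ_def, Complex.norm_real, Real.norm_eq_abs, sq_abs]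
    ring
  have hmass : 0 < ∫ t : ℝ, ‖φ t‖ ^ 2 := by
    rw [show (fun t : ℝ ↦ ‖φ t‖ ^ 2) = fun t ↦ χ t * χ t from funext hnorm]
    have hint : Integrable (fun t : ℝ ↦ χ t * χ t) :=
      (χ.continuous.mul χ.continuous).integrable_of_hasCompactSupport χ.hasCompactSupport.mul_right
    rw [integral_pos_iff_support_of_nonneg (fun t ↦ mul_self_nonneg (χ t)) hint]
    have hsupp : Function.support (fun t : ℝ ↦ χ t * χ t) = ball (c + D / 2) χ.rOut := by
      rw [← χ.support_eq]
      ext t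
      simp [Function.mem_support]
    rw [hsupp, Real.volume_ball]
    exact ENNReal.ofReal_pos.2 (by show 0 < 2 * (D / 2); linarith)
  exact lt_of_lt_of_le (mul_pos hcoef hmass) hge

/-- **An edge-layer function of positive energy exists on every window**: for `0 < q < q'` and any `η ≥ 0` there is
`h` with `Handoff.IsEdgeLayer q η ((log q')/2) h` (supported in `[(log q)/2, (log q')/2]`) and `0 < Re Q(h)`. [this track; Bombieri2000Weil Thm. 12] -/
theorem exists_isEdgeLayer_re_weilQuadratic_pos (hq : 0 < q) (hqq' : q < q') (hη : 0 ≤ η) :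
    ∃ h : ℝ → ℂ, Handoff.IsEdgeLayer q η (Real.log q' / 2) h ∧ 0 < (weilQuadratic h).re := by
  have hq0 : (0 : ℝ) < q := by exact_mod_cast hq
  have hlt : Real.log q < Real.log q' := Real.log_lt_log hq0 (by exact_mod_cast hqq')
  have hlq : 0 ≤ Real.log q := Real.log_natCast_nonneg q
  obtain ⟨φ, hφ, hsupp, hpos⟩ :=
    exists_isWeilTest_re_weilQuadratic_pos (Real.log q / 2) (δ := Real.log q' / 2 - Real.log q / 2) (by linarith)
  refine ⟨φ, ⟨hφ, hsupp.trans (Icc_subset_Icc (by linarith) (by linarith)), ?_⟩, hpos⟩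
  intro x hx
  by_contra hne
  have hxs : x ∈ tsupport φ := subset_tsupport _ (Function.mem_support.2 hne)
  have h1 : Real.log q / 2 ≤ x := (hsupp hxs).1
  linarith [le_abs_self x]

/-- **An old-cone function of positive energy exists**: for `q ≥ 2` there is `u ∈ C((log q)/2)` with `0 < Re Q(u)`.
[this track; Bombieri2000Weil Thm. 12] -/
theorem exists_oldCone_re_weilQuadratic_pos (hq : 2 ≤ q) :
    ∃ u : ℝ → ℂ, IsWeilTest u ∧ tsupport u ⊆ Icc (-(Real.log q / 2)) (Real.log q / 2) ∧
      0 < (weilQuadratic u).re := by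
  have hlq : 0 < Real.log q / 2 := by
    have := Real.log_pos (show (1 : ℝ) < q by exact_mod_cast hq)
    positivity
  obtain ⟨u, hu, hus, hpos⟩ := exists_isWeilTest_re_weilQuadratic_pos (-(Real.log q / 2)) hlq
  exact ⟨u, hu, hus.trans (Icc_subset_Icc le_rfl (by linarith)), hpos⟩

/-! ## §2  The coupling law is cumulative: it implies the induction hypothesis and the edge block -/

/-- **`Coupling(q) → WeilPositivityOn((log q)/2)`.**  The coupling law of `HandoffSchur.lean` at the window of
`q < q'` (any overlap `η ≥ 0`) IMPLIES Weil positivity on the whole old cone `C((log q)/2)` — i.e. the induction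
hypothesis, i.e. (for `q ≥ 3`) `H` of the previous prime: test the law against ONE edge-layer function `h` of
positive energy; `0 ≤ crossRe(u,h)² ≤ Re Q(u)·Re Q(h)` and `Re Q(h) > 0` force `Re Q(u) ≥ 0`.  So the coupling law is
NOT an increment statement. [this track (theory-1 gen2); Bombieri2000Weil §3] -/
theorem weilPositivityOn_of_handoffCoupling (hq : 0 < q) (hqq' : q < q') (hη : 0 ≤ η)
    (hC : Handoff.HandoffCoupling q q' η) : WeilPositivityOn (Real.log q / 2) := by
  intro u hu hus
  obtain ⟨h, hh, hpos⟩ := exists_isEdgeLayer_re_weilQuadratic_pos hq hqq' hη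
  have hq0 : (0 : ℝ) < q := by exact_mod_cast hq
  have hle : Real.log q / 2 ≤ Real.log q' / 2 := by
    have := Real.log_le_log hq0 (show (q : ℝ) ≤ q' by exact_mod_cast hqq'.le)
    linarith
  have key := hC (Real.log q' / 2) ⟨hle, le_rfl⟩ u h hu hus hh
  by_contra hneg
  rw [not_le] at hneg
  nlinarith [sq_nonneg (Handoff.crossRe u h), mul_neg_of_neg_of_pos hneg hpos]

/-- **`Coupling(q) → EdgeNonneg(q)`** (`q ≥ 2`, any `q'`, any `η`): test the law against ONE old-cone function `u` of
positive energy; `crossRe(u,h)² ≤ Re Q(u)·Re Q(h)` with `Re Q(u) > 0` forces `Re Q(h) ≥ 0` for every edge-layer `h`.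
[this track (theory-1 gen2)] -/
theorem edgeNonneg_of_handoffCoupling (hq : 2 ≤ q) (hC : Handoff.HandoffCoupling q q' η) :
    Handoff.EdgeNonneg q q' η := by
  intro b hb h hh
  obtain ⟨u, hu, hus, hupos⟩ := exists_oldCone_re_weilQuadratic_pos hq
  have key := hC b hb u h hu hus hh
  by_contra hneg
  rw [not_le] at hneg
  nlinarith [sq_nonneg (Handoff.crossRe u h), mul_neg_of_pos_of_neg hupos hneg]

/-- **`Coupling(q) → H(q)` with NO induction hypothesis** (consecutive primes `q < q'`, overlap `0 < η < (log q)/2`):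
the coupling law supplies its own induction hypothesis and its own edge block (§2), and prove-2's Schur step
`Handoff.handoffH_of_coupling` does the rest. [this track; HandoffSchur.lean (prove-2)] -/
theorem handoffH_of_handoffCoupling (hcons : Handoff.ConsecutivePrimes q q') (hη : 0 < η)
    (hη' : η < Real.log q / 2) (hC : Handoff.HandoffCoupling q q' η) : Handoff.HandoffH q q' :=
  Handoff.handoffH_of_coupling hcons hη hη'
    (weilPositivityOn_of_handoffCoupling hcons.1.pos hcons.2.2.1 hη.le hC)
    (edgeNonneg_of_handoffCoupling hcons.1.two_le hC) hC

/-- **THE COUPLING LAW IS `H(q)`: `HandoffCoupling q q' η ↔ HandoffH q q'`** for consecutive primes and any overlap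
`0 < η < (log q)/2` — unconditionally (prove-2's `handoffH_iff_edgeNonneg_and_coupling` needed the induction
hypothesis and the edge block on the left; both are consequences of the coupling law).  So the «RH-strength block»
of the Schur decomposition is not a block: it is Weil positivity on `C((log q')/2)` itself. [this track (theory-1 gen2); Bombieri2000Weil §3] -/
theorem handoffCoupling_iff_handoffH (hcons : Handoff.ConsecutivePrimes q q') (hη : 0 < η)
    (hη' : η < Real.log q / 2) : Handoff.HandoffCoupling q q' η ↔ Handoff.HandoffH q q' :=
  ⟨handoffH_of_handoffCoupling hcons hη hη', fun H ↦
    Handoff.handoffCoupling_of_weilPositivityOn hcons.1.pos hcons.2.2.1.le η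
      ((Handoff.handoffH_iff_weilPositivityOn hcons).1 H)⟩

/-- **SANDWICH**: `WeilPositivityOn((log q')/2) → Coupling(q, q', η) → WeilPositivityOn((log q)/2)` for `0 < q < q'`
and any `η ≥ 0` — the coupling law at `q` is pinned between two consecutive rungs of Weil positivity.
[this track (theory-1 gen2); HandoffSchur.lean (prove-2) for the left arrow] -/
theorem handoffCoupling_sandwich (hq : 0 < q) (hqq' : q < q') (hη : 0 ≤ η) :
    (WeilPositivityOn (Real.log q' / 2) → Handoff.HandoffCoupling q q' η) ∧
      (Handoff.HandoffCoupling q q' η → WeilPositivityOn (Real.log q / 2)) :=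
  ⟨Handoff.handoffCoupling_of_weilPositivityOn hq hqq'.le η, weilPositivityOn_of_handoffCoupling hq hqq' hη⟩

/-! ## §3  Consequences for the target: the edge block and the base drop out; the tail form is already RH -/

/-- **`RH ↔ ∀ q prime, Coupling(q, q⁺, η_q)`** for EVERY admissible overlap schedule `0 < η_q < (log q)/2`: neither
the edge block nor the base appears. [this track (theory-1 gen2); Bombieri2000Weil Thm. 2] -/
theorem riemannHypothesis_iff_forall_handoffCoupling {η : ℕ → ℝ}
    (hη : ∀ q : ℕ, q.Prime → 0 < η q ∧ η q < Real.log q / 2) :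
    Summit.RiemannHypothesis ↔ ∀ q : ℕ, q.Prime → Handoff.HandoffCoupling q (nextPrime q) (η q) := by
  rw [riemannHypothesis_iff_forall_handoffH]
  refine forall_congr' fun q ↦ forall_congr' fun hq ↦ ?_
  exact (handoffCoupling_iff_handoffH (consecutivePrimes_nextPrime hq) (hη q hq).1 (hη q hq).2).symm

/-- The quarter-window overlap `η_q = (log q)/4` is admissible for every prime. [folklore] -/
theorem quarter_overlap_admissible (hq : q.Prime) : 0 < Real.log q / 4 ∧ Real.log q / 4 < Real.log q / 2 := by
  have := Real.log_pos (show (1 : ℝ) < q by exact_mod_cast hq.one_lt)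
  constructor <;> linarith

/-- `RH ↔ ∀ q prime, Coupling(q, q⁺, (log q)/4)` (a concrete schedule). [this track (theory-1 gen2)] -/
theorem riemannHypothesis_iff_forall_handoffCoupling_quarter :
    Summit.RiemannHypothesis ↔ ∀ q : ℕ, q.Prime → Handoff.HandoffCoupling q (nextPrime q) (Real.log q / 4) :=
  riemannHypothesis_iff_forall_handoffCoupling fun _ hq ↦ quarter_overlap_admissible hq

/-- **NO ASYMPTOTIC DISCOUNT**: the tail form `∃ q₀, ∀ primes q ≥ q₀, Coupling(q)` already gives EVERY `H(q)` (for any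
overlap schedule with `η ≥ 0`; no upper constraint needed in this direction).  Contrast the increment form, whose tail
`∃ q₀, ∀ q ≥ q₀, HandoffStep q` is a theorem of excluded middle (`exists_forall_handoffStep`).  Proof: every window
lies below some large prime `q`, and `Coupling(q)` gives Weil positivity on `C((log q)/2)`. [this track (theory-1 gen2)] -/
theorem forall_handoffH_of_exists_forall_handoffCoupling {η : ℕ → ℝ} (hη : ∀ q : ℕ, q.Prime → 0 ≤ η q)
    (h : ∃ q₀ : ℕ, ∀ q : ℕ, q.Prime → q₀ ≤ q → Handoff.HandoffCoupling q (nextPrime q) (η q)) :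
    ∀ q : ℕ, q.Prime → HandoffH q := by
  obtain ⟨q₀, h⟩ := h
  intro P hP
  obtain ⟨q, hqge, hq⟩ := Nat.exists_infinite_primes (max q₀ (nextPrime P))
  have hC := h q hq ((le_max_left _ _).trans hqge)
  have hW := weilPositivityOn_of_handoffCoupling hq.pos (lt_nextPrime q) (hη q hq) hC
  rw [handoffH_iff_weilPositivityOn hP]
  refine hW.mono ?_
  have h1 : (nextPrime P : ℝ) ≤ q := by exact_mod_cast (le_max_right _ _).trans hqge
  have h0 : (0 : ℝ) < nextPrime P := by exact_mod_cast (nextPrime_prime P).pos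
  linarith [Real.log_le_log h0 h1]

/-- **`RH ↔ ∃ q₀, ∀ primes q ≥ q₀, Coupling(q, q⁺, η_q)`** for every admissible schedule: the tail form of the coupling
law is ALREADY RH — no asymptotic discount. [this track (theory-1 gen2)] -/
theorem riemannHypothesis_iff_exists_forall_handoffCoupling {η : ℕ → ℝ}
    (hη : ∀ q : ℕ, q.Prime → 0 < η q ∧ η q < Real.log q / 2) :
    Summit.RiemannHypothesis ↔
      ∃ q₀ : ℕ, ∀ q : ℕ, q.Prime → q₀ ≤ q → Handoff.HandoffCoupling q (nextPrime q) (η q) := by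
  refine ⟨fun hRH ↦ ⟨0, fun q hq _ ↦ (riemannHypothesis_iff_forall_handoffCoupling hη).1 hRH q hq⟩, fun h ↦ ?_⟩
  rw [riemannHypothesis_iff_forall_handoffH]
  exact forall_handoffH_of_exists_forall_handoffCoupling (fun q hq ↦ (hη q hq).1.le) h

/-- By contrast the EDGE block is RH-implied window by window: `H(q) → EdgeNonneg q q⁺ η` (any `η`). Its tail form is
RH-implied; its RH-free status is the prime-gap inequality of prove-2's ATTEMPT-4 (`edgeNonneg_of_crossBound`).
[this track; HandoffSchur.lean] -/
theorem HandoffH.edgeNonneg (hq : q.Prime) (h : HandoffH q) (η : ℝ) : Handoff.EdgeNonneg q (nextPrime q) η := by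
  have hW := (handoffH_iff_weilPositivityOn hq).1 h
  exact fun b hb g hg ↦ hW g hg.1 (hg.2.1.trans (Icc_subset_Icc (neg_le_neg hb.2) hb.2))

/-! ## §4  Dictionary with print: Connes's property `P(n)` (the equivalence-by-windows in the literature) -/

/-- **`H(q) → P(n)` for every `n ≤ q⁺`**: Connes's `P(n)` (Weil's inequality for test functions supported in
`[n^{−1/2}, n^{1/2}]` with `ĝ(±i/2) = 0`, "involving only the Euler factors for primes smaller than `n`") is the
POLE-FREE restriction of `WeilPositivityOn((log n)/2)`, and `H(q)` is the latter at `n = q⁺` without vanishing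
conditions.  The per-window converse `P(q⁺) → H(q)` is NOT claimed (open; it only matters under `¬RH`).
[cite: Connes2026Letter, §4.1 (arXiv pp. 20–21); ConnesConsaniMoscovici2024, p. 2–3 (property P(n))] -/
theorem HandoffH.weilPropertyP (hq : q.Prime) (h : HandoffH q) {n : ℕ} (hn : n ≤ nextPrime q) :
    weilPropertyP n :=
  (weilPropertyP_of_weilPositivityOn ((handoffH_iff_weilPositivityOn hq).1 h)).mono hn

/-- `H(q)` gives Connes–Consani's `QW_λ ≥ 0` (no vanishing conditions) for EVERY `λ² = n ≤ q⁺`, not only at prime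
`n`: indexing the windows by consecutive primes loses nothing (antitonicity). [cite: ConnesConsani2023, Prop. 2.1 (QW_λ); this track] -/
theorem HandoffH.weilPositivityOn_of_le (hq : q.Prime) (h : HandoffH q) {n : ℕ} (hn : n ≤ nextPrime q) :
    WeilPositivityOn (Real.log n / 2) := by
  refine ((handoffH_iff_weilPositivityOn hq).1 h).mono ?_
  rcases Nat.eq_zero_or_pos n with rfl | hn0
  · simp only [Nat.cast_zero, Real.log_zero, zero_div]
    have := Real.log_natCast_nonneg (nextPrime q)
    positivity
  · have h1 : (n : ℝ) ≤ nextPrime q := by exact_mod_cast hn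
    have h0 : (0 : ℝ) < n := by exact_mod_cast hn0
    linarith [Real.log_le_log h0 h1]

/-- `(∀ q prime, H q) → ∀ n, P(n)` directly (every `n` lies below the prime `(nextPrime n)⁺`). [cite: Connes2026Letter, §4.1 (arXiv pp. 20–21)] -/
theorem weilPropertyP_of_forall_handoffH (h : ∀ q : ℕ, q.Prime → HandoffH q) (n : ℕ) : weilPropertyP n :=
  (h (nextPrime n) (nextPrime_prime n)).weilPropertyP (nextPrime_prime n)
    ((lt_nextPrime n).le.trans (lt_nextPrime _).le)

/-- **The two equivalences-by-windows agree: `(∀ q prime, H q) ↔ ∀ n, P(n)`** — both are RH (this seat's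
`riemannHypothesis_iff_forall_handoffH`; cc-s2-4's `ConnesPropertyP.summit_iff_forall_weilPropertyP`, the printed
statement of Connes 2026 §4.1 / CCM 2024 discharged in the tree). [cite: Connes2026Letter, §4.1 (arXiv pp. 20–21); ConnesConsaniMoscovici2024 p. 2–3] -/
theorem forall_handoffH_iff_forall_weilPropertyP :
    (∀ q : ℕ, q.Prime → HandoffH q) ↔ ∀ n : ℕ, weilPropertyP n := by
  rw [← riemannHypothesis_iff_forall_handoffH]
  exact ConnesPropertyP.summit_iff_forall_weilPropertyP

end Summit.RiemannHypothesis.RiemannHypothesis.Theorems.HandoffDecomposition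

end
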